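import Summits.Ventures.LatticeQCDFlow.Scaling.FlowHubProposalLaw
import Summits.Ventures.LatticeQCDFlow.Scaling.TransportDefectCeiling

/-!
HONEST FRAMING: exact (Metropolis-corrected) sampling algorithms for lattice gauge theory; figures
of merit are autocorrelation/cost numbers at stated couplings and volumes; no continuum-physics
claim.

# HubExchangeLaw — THE MAP-ASSISTED HUB EXCHANGE SCHEME IN ONE STATEMENT: FOR A HUB LIST WITH ONE LEARNED BIJECTION PER
# COLD LEVEL, HOT-ONLY UPDATES AND TRANSPORTED DOMINATION `p`, (i) `Gap ≥ p·min{t·c/(6m), γ₀(1−t)/(14K)}`,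
# (ii) `Gap ≤ t·c_k/(2m·v)` AT EVERY COLD LEVEL, (iii) `Gap ≤ t/(2Kv)` WHATEVER THE PROPOSAL LAW, (iv) EVERY HUB ENTRY'S
# ACCEPTANCE SITS IN `[p, 1 − TV(μ_0, μ_{k+1}∘φ_k)]` (lean-2 GEN-23, ours)

Venture-side (OURS).  Cell `lqcd-flow` (pub-lqcd), unit `pub-lqcd-lean-2-g23`, 2026-08-26.  Chapter K, file 17: the
chapter's law for the scheme the flow literature runs — one tunnelling ensemble exchanging with `K` target ensembles
through trained maps — assembled from `Scaling/FlowHubProposalLaw` (K4), `Scaling/HubAcceptanceLaw` (K9) and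
`Scaling/TransportDefectCeiling` (K15).  Hub list `κ : Fin m → Fin K` (entry `r` = edge `(0, κ_r+1)`, `c_k =
#{r : κ_r = k}`, every `c_k ≥ c ≥ 1`), level maps `φ_k`, `P^φ = t·ptGraphSwap μ e φ + (1−t)·prodKernel 𝟙_{k=0} M`.

## What is proved

* **`flowHub_exchangeLaw`** — `K, m ≥ 1`, `|S| ≥ 2`, `0 < t < 1`, `0 < p ≤ 1`, transported domination
  `p·μ_{k+1}(φ_k u) ≤ μ_0(u)`, hot update `μ_0`-reversible with Poincaré constant `γ₀`, a set `A` with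
  `μ_{k+1}(φ_k A)·μ_{k+1}(φ_k Aᶜ) ≥ v > 0` at every cold level:
  (i) `p·min{t·c/(6m), γ₀(1−t)/(14K)} ≤ Gap(P^φ)`;
  (ii) `Gap(P^φ) ≤ t·c_k/(2m·v)` for every `k`;
  (iii) `Gap(P^φ) ≤ t/(2K·v)`;
  (iv) `p ≤ α_k ≤ 1 − ½Σ_u|μ_0(u) − μ_{k+1}(φ_k u)|` for every `k`, `α_k = Σ_x min{π̃(x), π̃(edgeFlowSwap φ_k 0 (k+1) x)}`
  the stationary acceptance of the `(0, k+1)` exchange.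

Reading (no numerics implied): the exact flow-assisted hub sampler relaxes at the rarest hub edge's proposal frequency,
up to the factor between the domination constant `p` and one; `p` is visible from below in every hub acceptance and is
capped by the maps' transport defects; nothing about the proposal law can lift the rate above the uniform hub's
`t/(2Kv)`.  NOT CLAIMED: the cost statements (`Scaling/ExchangeCostLaw`, `Scaling/AllocationCostLaw`) in level
coordinates; continuous spaces; anything measured.  Literature grade (cell rule): OWN COMPOSITION; nothing cited as a
fact; no new bib keys.
-/

noncomputable section

open Finset Function
open Literature.Probability.MarkovChains

namespace Summit.Ventures.LatticeQCDFlow.Scaling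

variable {S : Type*} [Fintype S] [DecidableEq S] {K m : ℕ} {μ : Fin (K + 1) → S → ℝ}
  {M : Fin (K + 1) → S → S → ℝ} {t : ℝ}

/-- **THE HUB EXCHANGE LAW WITH MAPS** (floor, rarest-edge ceiling, uniform ceiling, acceptance window). [ours] -/
theorem flowHub_exchangeLaw [Nontrivial S] (κ : Fin m → Fin K) (φ : Fin K → Equiv.Perm S) (hK : 1 ≤ K) (hm : 1 ≤ m)
    {c : ℕ} (hc : ∀ k : Fin K, c ≤ (univ.filter (fun r : Fin m => κ r = k)).card) (hc1 : 1 ≤ c)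
    (hμ : ∀ k x, 0 < μ k x) (hμ1 : ∀ k, ∑ u, μ k u = 1) (hM : ∀ k, IsRowStochastic (M k))
    (hMrev : ∀ k, DetailedBalance (μ k) (M k)) (ht0 : 0 < t) (ht1 : t < 1) {p γ₀ : ℝ} (hp : 0 < p) (hp1 : p ≤ 1)
    (hγ₀ : 0 < γ₀) (hdom : ∀ (k : Fin K) (u : S), p * μ k.succ (φ k u) ≤ μ 0 u)
    (hgap0 : ∀ g : S → ℝ, γ₀ * lawVariance (μ 0) g ≤ dirichletForm (μ 0) (M 0) g) {A : Finset S} {v : ℝ}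
    (hvpos : 0 < v) (hv : ∀ k : Fin K, v ≤ (∑ u ∈ A, μ k.succ (φ k u)) * ∑ u ∈ Aᶜ, μ k.succ (φ k u)) :
    p * min (t * c / (6 * m)) (γ₀ * (1 - t) / (14 * K))
        ≤ spectralGap (tensorFun μ) (fun x y : Fin (K + 1) → S =>
            t * ptGraphSwap μ (fun r : Fin m => ((0 : Fin (K + 1)), (κ r).succ)) (fun r => φ (κ r)) x y
              + (1 - t) * prodKernel (fun i : Fin (K + 1) => if i = 0 then (1 : ℝ) else 0) M x y)
      ∧ (∀ k : Fin K, spectralGap (tensorFun μ) (fun x y : Fin (K + 1) → S =>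
            t * ptGraphSwap μ (fun r : Fin m => ((0 : Fin (K + 1)), (κ r).succ)) (fun r => φ (κ r)) x y
              + (1 - t) * prodKernel (fun i : Fin (K + 1) => if i = 0 then (1 : ℝ) else 0) M x y)
          ≤ t * ((univ.filter (fun r : Fin m => κ r = k)).card : ℝ) / (2 * m * v))
      ∧ spectralGap (tensorFun μ) (fun x y : Fin (K + 1) → S =>
            t * ptGraphSwap μ (fun r : Fin m => ((0 : Fin (K + 1)), (κ r).succ)) (fun r => φ (κ r)) x y
              + (1 - t) * prodKernel (fun i : Fin (K + 1) => if i = 0 then (1 : ℝ) else 0) M x y)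
          ≤ t / (2 * K * v)
      ∧ (∀ k : Fin K, p ≤ ∑ x : Fin (K + 1) → S, min (tensorFun μ x) (tensorFun μ (edgeFlowSwap (φ k) 0 k.succ x))
          ∧ ∑ x : Fin (K + 1) → S, min (tensorFun μ x) (tensorFun μ (edgeFlowSwap (φ k) 0 k.succ x))
              ≤ 1 - (1 / 2) * ∑ u, |μ 0 u - μ k.succ (φ k u)|) := by
  have hw0 : ∀ i : Fin (K + 1), 0 ≤ (if i = 0 then (1 : ℝ) else 0) := fun i => by positivity
  obtain ⟨k₀⟩ : Nonempty (Fin K) := ⟨⟨0, by omega⟩⟩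
  refine ⟨(flowHubList_spectralGap_two_sided κ φ hK hm hc hc1 hμ hμ1 hM hMrev ht0 ht1 hp hp1 hγ₀ hdom hgap0 hvpos k₀
    (hv k₀)).1, fun k => (flowHubList_spectralGap_two_sided κ φ hK hm hc hc1 hμ hμ1 hM hMrev ht0 ht1 hp hp1 hγ₀ hdom
    hgap0 hvpos k (hv k)).2, ?_, fun k => hubEdge_acceptance_two_sided hμ hμ1 (φ k) k (hdom k)⟩
  exact flowHubList_spectralGap_le_uniformLaw κ φ (M := M) (w := fun i : Fin (K + 1) => if i = 0 then (1 : ℝ) else 0)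
    hK hm hμ hμ1 hM hMrev hw0 hotOnlyWeight_sum ht0.le ht1.le hvpos hv
    (fun k => by rw [if_neg (Fin.succ_ne_zero k), zero_mul])

end Summit.Ventures.LatticeQCDFlow.Scaling

end
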